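import Literature.NumberTheory.Automorphic.AdelicSchwartzBruhatTensor
import HarnessLib

/-!
# LF-continuity of linear operators on the adelic Schwartz–Bruhat space `𝒮(𝔸_K^ι)`

The tree's adelic Schwartz–Bruhat space `piSchwartzBruhat K ι` is LITERALLY the algebraic tensor product
`𝓢(X_∞) ⊗_ℂ 𝒮(X_f)` (`piSchwartzBruhatEquiv`, `AdelicSchwartzBruhatTensor`), `X_∞ = (K ⊗ ℝ)^ι`, `X_f = 𝔸_{K,f}^ι`.
Its natural topology [Weil1964, n° 11; Bruhat 1961] is the strict inductive limit of the Fréchet spaces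
`𝓢(X_∞) ⊗ V`, `V ⊆ 𝒮(X_f)` finite-dimensional (a level piece): every element lies in such a piece.

For that topology a LINEAR operator `M` is continuous iff, on each piece, it is a FINITE SUM of continuous
operators of `𝓢(X_∞)` tensored with fixed finite vectors — for a continuous `M` each Fréchet piece lands in a
finite piece (Baire / Grothendieck factorisation) and the coordinate maps are continuous; conversely such an `M`
is continuous on every piece, hence on the inductive limit. We take this FINITE CONTINUOUS EXPANSION as the
DEFINITION (`IsLFContinuous`): it is stated purely in terms of `piSchwartzBruhatEquiv`, Mathlib's Fréchet topology
on `SchwartzMap`, and finite sums, so that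

* the identity, composites (`IsLFContinuous.comp`) and tensor-product operators `A ⊗ B` with `A` a continuous
  linear map of `𝓢(X_∞)` (`isLFContinuous_adelicTensorEnd`) are LF-continuous by pure algebra;
* every archimedean BLOCK `φ ↦ (id ⊗ λ_f)(M(φ ⊗ Φ_f))` of an LF-continuous `M` is a continuous linear map of
  `𝓢(X_∞)` (`IsLFContinuous.continuous_lfBlock`) — the form in which archimedean tensor-stripping consumes it;
* the LF-continuous automorphisms form a subgroup `lfUnits K ι ≤ GL(𝒮(𝔸_K^ι))` (both `M` and `M⁻¹` LF-continuous).

The metaplectic group OF RECORD over the adeles is cut out by this subgroup (`Weil1964/AdelicMetaplecticContinuous`):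
Weil's metaplectic operators are automorphisms of the topological vector space `𝒮(X_A)` [Weil1964, Chap. I,
n° 11–13; n° 39 p. 189], so asking for LF-continuous implementers is weaker than or equal to print. Kernel only.
-/

noncomputable section

namespace Literature.NumberTheory.Automorphic

open NumberField NumberField.mixedEmbedding TensorProduct
open scoped SchwartzMap TensorProduct Classical

variable {K : Type} [Field K] [NumberField K] {ι : Type} [Fintype ι]

/-! ## §1. The definition -/

/-- **LF-continuity** of a linear operator `M` of `𝒮(𝔸_K^ι) = 𝓢(X_∞) ⊗ 𝒮(X_f)` (finite continuous expansion on
every Fréchet piece): for every `Φ_f ∈ 𝒮(X_f)` there are finitely many CONTINUOUS linear maps `A_j` of `𝓢(X_∞)` and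
vectors `Ψ_j ∈ 𝒮(X_f)` with `M(φ ⊗ Φ_f) = ∑_j A_j φ ⊗ Ψ_j` for all `φ ∈ 𝓢(X_∞)`. Equivalent to continuity for the
strict inductive-limit topology `𝒮(𝔸_K^ι) = lim→ 𝓢(X_∞) ⊗ V` (`V` finite-dimensional); used here only through its
algebraic closure properties. [cite: Weil1964, Chap. I n° 11 p. 155–156 (the inductive-limit topology of 𝒮(G))] -/
def IsLFContinuous (M : ↥(piSchwartzBruhat K ι) →ₗ[ℂ] ↥(piSchwartzBruhat K ι)) : Prop :=
  ∀ Φf : FinSB K ι, ∃ (κ : Type) (_ : Fintype κ)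
    (A : κ → (𝓢((ι → mixedSpace K), ℂ) →L[ℂ] 𝓢((ι → mixedSpace K), ℂ))) (Ψ : κ → FinSB K ι),
    ∀ φ : 𝓢((ι → mixedSpace K), ℂ),
      M (piSchwartzBruhatEquiv K ι (φ ⊗ₜ Φf)) = ∑ j, piSchwartzBruhatEquiv K ι (A j φ ⊗ₜ Ψ j)

/-! ## §2. Algebraic closure properties -/

/-- The identity is LF-continuous. [folklore] -/
theorem isLFContinuous_id : IsLFContinuous (LinearMap.id : ↥(piSchwartzBruhat K ι) →ₗ[ℂ] ↥(piSchwartzBruhat K ι)) :=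
  fun Φf => ⟨Unit, inferInstance, fun _ => ContinuousLinearMap.id ℂ _, fun _ => Φf, fun φ => by
    rw [LinearMap.id_apply, Finset.univ_unique, Finset.sum_singleton, ContinuousLinearMap.coe_id', id_eq]⟩

/-- Composites of LF-continuous operators are LF-continuous (the expansion of `M ∘ N` on a piece is the double sum
of the expansions). [folklore] -/
theorem IsLFContinuous.comp {M N : ↥(piSchwartzBruhat K ι) →ₗ[ℂ] ↥(piSchwartzBruhat K ι)} (hM : IsLFContinuous M)
    (hN : IsLFContinuous N) : IsLFContinuous (M ∘ₗ N) := by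
  intro Φf
  obtain ⟨κ, _, B, Ψ, hN'⟩ := hN Φf
  choose κ' inst A Ψ' hM' using fun j : κ => hM (Ψ j)
  refine ⟨(j : κ) × κ' j, inferInstance, fun jk => (A jk.1 jk.2).comp (B jk.1), fun jk => Ψ' jk.1 jk.2, fun φ => ?_⟩
  rw [LinearMap.comp_apply, hN', map_sum, Fintype.sum_sigma]
  exact Finset.sum_congr rfl fun j _ => hM' j (B j φ)

/-- **`A ⊗ B` is LF-continuous** when `A : 𝓢(X_∞) →L[ℂ] 𝓢(X_∞)` is continuous (`B` any linear operator of
`𝒮(X_f)`): `(A ⊗ B)(φ ⊗ Φ_f) = A φ ⊗ B Φ_f`, a one-term expansion. This covers translations / linear changes of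
variable / multiplication by characters / Fourier transforms assembled as tensor products. [folklore] -/
theorem isLFContinuous_adelicTensorEnd (A : 𝓢((ι → mixedSpace K), ℂ) →L[ℂ] 𝓢((ι → mixedSpace K), ℂ))
    (B : FinSB K ι →ₗ[ℂ] FinSB K ι) :
    IsLFContinuous (adelicTensorEnd (A : 𝓢((ι → mixedSpace K), ℂ) →ₗ[ℂ] 𝓢((ι → mixedSpace K), ℂ)) B) :=
  fun Φf => ⟨Unit, inferInstance, fun _ => A, fun _ => B Φf, fun φ => by
    rw [adelicTensorEnd_apply_tmul, Finset.univ_unique, Finset.sum_singleton, ContinuousLinearMap.coe_coe]⟩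

/-- An operator that AGREES with an LF-continuous one is LF-continuous (transport along equalities of bundled
maps, e.g. `↑(M * N) = ↑M ∘ₗ ↑N`). [folklore] -/
theorem IsLFContinuous.congr {M N : ↥(piSchwartzBruhat K ι) →ₗ[ℂ] ↥(piSchwartzBruhat K ι)} (hM : IsLFContinuous M)
    (h : ∀ Φ, N Φ = M Φ) : IsLFContinuous N := by
  intro Φf
  obtain ⟨κ, _, A, Ψ, hM'⟩ := hM Φf
  exact ⟨κ, inferInstance, A, Ψ, fun φ => (h _).trans (hM' φ)⟩

/-! ## §3. Archimedean blocks -/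

/-- The **archimedean block** of `M` at `(Φ_f, λ_f)`: `φ ↦ (id ⊗ λ_f)(M(φ ⊗ Φ_f)) ∈ 𝓢(X_∞)`, read through
`piSchwartzBruhatEquiv`. [folklore] -/
def lfBlock (M : ↥(piSchwartzBruhat K ι) →ₗ[ℂ] ↥(piSchwartzBruhat K ι)) (Φf : FinSB K ι) (ℓ : FinSB K ι →ₗ[ℂ] ℂ) :
    𝓢((ι → mixedSpace K), ℂ) →ₗ[ℂ] 𝓢((ι → mixedSpace K), ℂ) :=
  (TensorProduct.rid ℂ 𝓢((ι → mixedSpace K), ℂ)).toLinearMap ∘ₗ LinearMap.lTensor 𝓢((ι → mixedSpace K), ℂ) ℓ ∘ₗ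
    (piSchwartzBruhatEquiv K ι).symm.toLinearMap ∘ₗ M ∘ₗ (piSchwartzBruhatEquiv K ι).toLinearMap ∘ₗ
      (TensorProduct.mk ℂ 𝓢((ι → mixedSpace K), ℂ) (FinSB K ι)).flip Φf

/-- Unfolding `lfBlock`. [folklore] -/
theorem lfBlock_apply (M : ↥(piSchwartzBruhat K ι) →ₗ[ℂ] ↥(piSchwartzBruhat K ι)) (Φf : FinSB K ι)
    (ℓ : FinSB K ι →ₗ[ℂ] ℂ) (φ : 𝓢((ι → mixedSpace K), ℂ)) :
    lfBlock M Φf ℓ φ = TensorProduct.rid ℂ 𝓢((ι → mixedSpace K), ℂ)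
      (LinearMap.lTensor 𝓢((ι → mixedSpace K), ℂ) ℓ
        ((piSchwartzBruhatEquiv K ι).symm (M (piSchwartzBruhatEquiv K ι (φ ⊗ₜ Φf))))) := rfl

/-- The block of an operator with a finite continuous expansion `M(φ ⊗ Φ_f) = ∑ A_j φ ⊗ Ψ_j` is `∑ λ_f(Ψ_j) A_j`.
[folklore] -/
theorem lfBlock_apply_of_expansion {M : ↥(piSchwartzBruhat K ι) →ₗ[ℂ] ↥(piSchwartzBruhat K ι)} {Φf : FinSB K ι}
    {κ : Type} [Fintype κ] {A : κ → (𝓢((ι → mixedSpace K), ℂ) →L[ℂ] 𝓢((ι → mixedSpace K), ℂ))} {Ψ : κ → FinSB K ι}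
    (hM : ∀ φ : 𝓢((ι → mixedSpace K), ℂ),
      M (piSchwartzBruhatEquiv K ι (φ ⊗ₜ Φf)) = ∑ j, piSchwartzBruhatEquiv K ι (A j φ ⊗ₜ Ψ j))
    (ℓ : FinSB K ι →ₗ[ℂ] ℂ) (φ : 𝓢((ι → mixedSpace K), ℂ)) :
    lfBlock M Φf ℓ φ = ∑ j, ℓ (Ψ j) • A j φ := by
  rw [lfBlock_apply, hM, ← map_sum, LinearEquiv.symm_apply_apply, map_sum, map_sum]
  exact Finset.sum_congr rfl fun j _ => by rw [LinearMap.lTensor_tmul, TensorProduct.rid_tmul]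

/-- **Blocks of an LF-continuous operator are continuous** linear maps of `𝓢(X_∞)`. [folklore] -/
theorem IsLFContinuous.continuous_lfBlock {M : ↥(piSchwartzBruhat K ι) →ₗ[ℂ] ↥(piSchwartzBruhat K ι)}
    (hM : IsLFContinuous M) (Φf : FinSB K ι) (ℓ : FinSB K ι →ₗ[ℂ] ℂ) : Continuous (lfBlock M Φf ℓ) := by
  obtain ⟨κ, _, A, Ψ, hM'⟩ := hM Φf
  have h : (lfBlock M Φf ℓ : 𝓢((ι → mixedSpace K), ℂ) → 𝓢((ι → mixedSpace K), ℂ)) =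
      fun φ => ∑ j, ℓ (Ψ j) • A j φ := funext fun φ => lfBlock_apply_of_expansion hM' ℓ φ
  rw [h]
  exact continuous_finsetSum _ fun j _ => (continuous_const_smul (ℓ (Ψ j))).comp (A j).continuous

/-- The block of an LF-continuous operator as a CONTINUOUS linear map. [folklore] -/
def IsLFContinuous.lfBlockCLM {M : ↥(piSchwartzBruhat K ι) →ₗ[ℂ] ↥(piSchwartzBruhat K ι)} (hM : IsLFContinuous M)
    (Φf : FinSB K ι) (ℓ : FinSB K ι →ₗ[ℂ] ℂ) : 𝓢((ι → mixedSpace K), ℂ) →L[ℂ] 𝓢((ι → mixedSpace K), ℂ) :=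
  ⟨lfBlock M Φf ℓ, hM.continuous_lfBlock Φf ℓ⟩

/-- `hM.lfBlockCLM Φf ℓ φ = lfBlock M Φf ℓ φ`. [folklore] -/
@[simp] theorem IsLFContinuous.lfBlockCLM_apply {M : ↥(piSchwartzBruhat K ι) →ₗ[ℂ] ↥(piSchwartzBruhat K ι)}
    (hM : IsLFContinuous M) (Φf : FinSB K ι) (ℓ : FinSB K ι →ₗ[ℂ] ℂ) (φ : 𝓢((ι → mixedSpace K), ℂ)) :
    hM.lfBlockCLM Φf ℓ φ = lfBlock M Φf ℓ φ := rfl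

/-- The block of a tensor-product operator: `lfBlock (A ⊗ B) Φ_f λ_f = λ_f(B Φ_f) • A`. [folklore] -/
theorem lfBlock_adelicTensorEnd (A : 𝓢((ι → mixedSpace K), ℂ) →ₗ[ℂ] 𝓢((ι → mixedSpace K), ℂ))
    (B : FinSB K ι →ₗ[ℂ] FinSB K ι) (Φf : FinSB K ι) (ℓ : FinSB K ι →ₗ[ℂ] ℂ) (φ : 𝓢((ι → mixedSpace K), ℂ)) :
    lfBlock (adelicTensorEnd A B) Φf ℓ φ = ℓ (B Φf) • A φ := by
  rw [lfBlock_apply, adelicTensorEnd_apply_tmul, LinearEquiv.symm_apply_apply, LinearMap.lTensor_tmul,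
    TensorProduct.rid_tmul]

/-- **Stripping lemma (pure-tensor form).** If an LF-continuous `M` acts on the piece of `Φ_f ≠ 0` as `φ ⊗ Φ_f ↦ A φ ⊗ Φ_f`
for SOME function `A`, then `A` is a continuous linear map of `𝓢(X_∞)` — namely the block of `M` at `(Φ_f, λ_f)` for any
`λ_f` with `λ_f(Φ_f) = 1`. [folklore] -/
theorem IsLFContinuous.continuous_of_tmul {M : ↥(piSchwartzBruhat K ι) →ₗ[ℂ] ↥(piSchwartzBruhat K ι)}
    (hM : IsLFContinuous M) {Φf : FinSB K ι} {ℓ : FinSB K ι →ₗ[ℂ] ℂ} (hℓ : ℓ Φf = 1)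
    {A : 𝓢((ι → mixedSpace K), ℂ) → 𝓢((ι → mixedSpace K), ℂ)}
    (hA : ∀ φ, M (piSchwartzBruhatEquiv K ι (φ ⊗ₜ Φf)) = piSchwartzBruhatEquiv K ι (A φ ⊗ₜ Φf)) :
    A = lfBlock M Φf ℓ ∧ Continuous A := by
  have h : A = lfBlock M Φf ℓ := by
    funext φ
    rw [lfBlock_apply, hA, LinearEquiv.symm_apply_apply, LinearMap.lTensor_tmul, TensorProduct.rid_tmul, hℓ,
      one_smul]
  exact ⟨h, h ▸ hM.continuous_lfBlock Φf ℓ⟩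

/-! ## §4. The subgroup of LF-continuous automorphisms -/

variable (K ι)

/-- **`GL(𝒮(𝔸_K^ι))ᶜᵒⁿᵗ`**: the linear automorphisms `M` of `piSchwartzBruhat K ι` with `M` AND `M⁻¹` LF-continuous —
a subgroup of Mathlib's `LinearEquiv.automorphismGroup`. [folklore] -/
def lfUnits : Subgroup (↥(piSchwartzBruhat K ι) ≃ₗ[ℂ] ↥(piSchwartzBruhat K ι)) where
  carrier := {M | IsLFContinuous (M : ↥(piSchwartzBruhat K ι) →ₗ[ℂ] ↥(piSchwartzBruhat K ι)) ∧
    IsLFContinuous (M.symm : ↥(piSchwartzBruhat K ι) →ₗ[ℂ] ↥(piSchwartzBruhat K ι))}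
  one_mem' := ⟨isLFContinuous_id.congr fun _ => rfl, isLFContinuous_id.congr fun _ => rfl⟩
  mul_mem' := fun {M N} hM hN =>
    ⟨(hM.1.comp hN.1).congr fun _ => rfl, (hN.2.comp hM.2).congr fun Φ => by
      change (M * N).symm Φ = N.symm (M.symm Φ)
      rw [LinearEquiv.symm_apply_eq, LinearEquiv.mul_apply, LinearEquiv.apply_symm_apply,
        LinearEquiv.apply_symm_apply]⟩
  inv_mem' := fun {M} hM => ⟨hM.2.congr fun _ => rfl, hM.1.congr fun _ => rfl⟩

variable {K ι}

/-- Membership in `lfUnits`. [folklore] -/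
theorem mem_lfUnits_iff (M : ↥(piSchwartzBruhat K ι) ≃ₗ[ℂ] ↥(piSchwartzBruhat K ι)) :
    M ∈ lfUnits K ι ↔ IsLFContinuous (M : ↥(piSchwartzBruhat K ι) →ₗ[ℂ] ↥(piSchwartzBruhat K ι)) ∧
      IsLFContinuous (M.symm : ↥(piSchwartzBruhat K ι) →ₗ[ℂ] ↥(piSchwartzBruhat K ι)) :=
  Iff.rfl

/-- A tensor-product AUTOMORPHISM `A ⊗ B` with `A`, `A⁻¹` continuous lies in `lfUnits`: the case of all the
generators' implementers (stated for an automorphism `M` that agrees with `A ⊗ B` and whose inverse agrees with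
`A' ⊗ B'`, `A, A'` continuous). [folklore] -/
theorem mem_lfUnits_of_tensor (M : ↥(piSchwartzBruhat K ι) ≃ₗ[ℂ] ↥(piSchwartzBruhat K ι))
    (A A' : 𝓢((ι → mixedSpace K), ℂ) →L[ℂ] 𝓢((ι → mixedSpace K), ℂ)) (B B' : FinSB K ι →ₗ[ℂ] FinSB K ι)
    (hM : ∀ Φ, M Φ = adelicTensorEnd (A : 𝓢((ι → mixedSpace K), ℂ) →ₗ[ℂ] 𝓢((ι → mixedSpace K), ℂ)) B Φ)
    (hM' : ∀ Φ, M.symm Φ = adelicTensorEnd (A' : 𝓢((ι → mixedSpace K), ℂ) →ₗ[ℂ] 𝓢((ι → mixedSpace K), ℂ)) B' Φ) :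
    M ∈ lfUnits K ι :=
  ⟨(isLFContinuous_adelicTensorEnd A B).congr hM, (isLFContinuous_adelicTensorEnd A' B').congr hM'⟩

end Literature.NumberTheory.Automorphic

end
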